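import Literature.AlgebraicGeometry.Motives.CartierDivisorLineBundleIsoRatFn
import HarnessLib

/-!
# Trivialisations `𝒪_Y(D) ≅ 𝒪_Y` from rational functions: the converse of
# `CartierDivisorLineBundleIsoRatFn` (Görtz–Wedhorn I, Prop. 11.21: `𝒪_Y(D) ≅ 𝒪_Y` iff `D` is principal)

Layer `Literature/AlgebraicGeometry/Motives`, namespace `Literature.AlgebraicGeometry.Motives.CartierDivisor` (dot
notation on `D`). DEFINITIONS WITH BODIES AND THEOREMS ONLY (no named fact, no instance, no notation, no `sorry`);
everything is proved.

For a Cartier divisor `D = (U_i, f_i)` on an integral scheme `Y`, ★ `Motives/CartierDivisorLineBundleIsoRatFn` reads an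
isomorphism `e : Modules.lineBundle D.toUnitCocycle ≅ 𝒪_Y` of the glued line bundle (★ `Modules/LineBundleOfCocycle`) as
a rational function `h ∈ K(Y)^×` with `e(s) = φ(s) · h` for every section `s` (`φ = lineBundleRatFn`, ★
`CartierDivisorLineBundleSectionsOn`) and `h / f_i ∈ Γ(U_i, 𝒪_Y^×)` (`exists_ratFn_of_iso_unit`). This file proves
the CONVERSE and the FAITHFULNESS of that reading ([GortzWedhorn2020] Section (11.9) p. 301 and Prop. 11.21 p. 302: «`𝒪_X(D) ≅ 𝒪_X`
if and only if `D` is principal»; the map `D ↦ 𝒪_X(D)` is a homomorphism `Div(X) → Pic(X)` whose kernel is the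
principal divisors):

* `CartierDivisor.unitIsoOfRatFn D h hD : Modules.lineBundle D.toUnitCocycle ≅ 𝒪_Y` — **multiplication by `h`**, for
  any `h` with `h / f_i` a unit on every `U_i` (equivalently `div(h)` and `D` are the same divisor,
  `sameDivisor_principal_iff`): on sections over a non-empty open `W` it is `s ↦ (the section of) φ(s) · h`
  (`ofSection_unitIsoOfRatFn_hom_app` — literally the clause of `exists_ratFn_of_iso_unit`), its inverse is
  `b ↦ (the section with rational function) b / h` (`lineBundleRatFn_unitIsoOfRatFn_inv_app`), and it maps the local
  generator `t_z` to `h / f_{i(z)}` (`ofSection_unitIsoOfRatFn_hom_app_lineBundleGen`);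
* **faithfulness**: a morphism `Modules.lineBundle D.toUnitCocycle ⟶ 𝒪_Y` is determined by the rational functions of
  its values (`hom_ext_ofSection`); hence an isomorphism `e` with `e(s) = φ(s) · h` IS `unitIsoOfRatFn D h`
  (`eq_unitIsoOfRatFn`), and EVERY isomorphism `𝒪_Y(D) ≅ 𝒪_Y` is of this form (`exists_eq_unitIsoOfRatFn`): isomorphisms
  `𝒪_Y(D) ≅ 𝒪_Y` correspond exactly to the rational functions `h` with `h / f_i ∈ Γ(U_i, 𝒪_Y^×)`;
* the **principal** case: `principalUnitIso h hh : Modules.lineBundle (principal h hh).toUnitCocycle ≅ 𝒪_Y`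
  (multiplication by `h`; [GortzWedhorn2020] (11.9): `𝒪_X(div h) = h⁻¹ 𝒪_X ⊆ 𝒦_X`).

Engines (all ★ / Mathlib): `RatFn.sectionOf` / `ofSection_sectionOf` / `RatFn.section_ext` (`Γ(U, 𝒪_Y) = ⋂ 𝒪_{Y,y}` in
`K(Y)`, [GortzWedhorn2020] Prop. 3.29 (2)(3), p. 80), `CartierDivisor.lineBundleRatFn` / `lineBundleSectionOfRatFn` and their
additivity, semilinearity and restriction rules, `UnitCocycle.section_ext`, Mathlib `PresheafOfModules.homMk`,
`Scheme.Modules.hom_ext`. Mathlib searched (pin): no Cartier divisors / `𝒪_X(D)` / `Pic` for schemes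
(`Mathlib/AlgebraicGeometry/Modules/`: `Sheaf`, `Presheaf`, `Tilde` only); `SheafOfModules.unit`, `unitHomEquiv` (not used:
sections here are chart families, the explicit `homMk` keeps the values definitional).

Consumer: cell hodgecm-mathlib (h9-S) (W2): a CHOSEN trivialisation `[n]^*𝒪(D_Q) ≅ 𝒪` whose rational function is a
prescribed trivializer (★ `AbelianVarietyWeilPairingLevel.weilFn`), and the fact that any two trivialisations differ by
a global unit read in `K(Y)`. Count-neutral; HC_CM is proved only modulo the 7 printed citations until rung 0 closes.

## References
* [GortzWedhorn2020] U. Görtz, T. Wedhorn, *Algebraic Geometry I: Schemes*, 2nd ed., Springer Spektrum (2020): Section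
  (11.9) «Divisors on integral schemes» (p. 301: `𝒪_X(D)`, principal divisors, `𝒪_X(D)|_{U_i} = f_i⁻¹ 𝒪_{U_i}`, Def. 11.20),
  Prop. 11.21 (p. 302), Prop. 3.29 (2)(3) (p. 80; integral schemes: `Γ(U, 𝒪_X) ↪ K(X)`, `Γ(U, 𝒪_X) = ⋂ 𝒪_{X,x}`), Rem. 11.16
  (cocycles and glued modules).
-/

noncomputable section

open CategoryTheory AlgebraicGeometry Opposite TopologicalSpace

namespace Literature.AlgebraicGeometry.Motives.CartierDivisor

open RatFn Literature.AlgebraicGeometry.Modules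

universe u

variable {Y : Scheme.{u}} [IsIntegral Y] (D : CartierDivisor Y)

/-! ### §0 Sections of the glued line bundle are determined by their rational functions -/

/-- **Sections of `Modules.lineBundle D.toUnitCocycle` over `W` with the same rational function are equal** (over a
non-empty `W` the map `φ` is injective — ★ `eq_zero_of_lineBundleRatFn_eq_zero` —; over `W = ∅` every component
`s_x ∈ Γ(∅ ∩ U_x, 𝒪_Y)` lives in the zero ring). [cite: GortzWedhorn2020, Section (11.9) (p. 301) with Prop. 3.29 (2) (p. 80)] -/
theorem lineBundle_section_ext {W : Y.Opens} {s t : Γ(Modules.lineBundle D.toUnitCocycle, W)}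
    (h : ∀ hW : genericPoint Y ∈ W, D.lineBundleRatFn hW s = D.lineBundleRatFn hW t) : s = t := by
  refine UnitCocycle.section_ext _ fun x => RatFn.section_ext fun hV => ?_
  have hW : genericPoint Y ∈ W := hV.1
  rw [D.ofSection_comp_eq hW s x, D.ofSection_comp_eq hW t x, h hW]

/-- **A morphism `Modules.lineBundle D.toUnitCocycle ⟶ 𝒪_Y` is determined by the rational functions of its values** on
sections over non-empty opens ([GortzWedhorn2020] Prop. 3.29 (2): `Γ(W, 𝒪_Y) → K(Y)` is injective for `W ≠ ∅`; over
`W = ∅` the ring of sections is trivial). [cite: GortzWedhorn2020, Prop. 3.29 (2) (p. 80)] -/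
theorem hom_ext_ofSection {φ ψ : Modules.lineBundle D.toUnitCocycle ⟶ SheafOfModules.unit Y.ringCatSheaf}
    (H : ∀ (W : Y.Opens) (hW : genericPoint Y ∈ W) (s : Γ(Modules.lineBundle D.toUnitCocycle, W)),
      ofSection hW (show Γ(Y, W) from φ.app W s) = ofSection hW (show Γ(Y, W) from ψ.app W s)) :
    φ = ψ :=
  Scheme.Modules.hom_ext _ _ fun W => AddCommGrpCat.ext fun s =>
    RatFn.section_ext (U := W) (σ := show Γ(Y, W) from φ.app W s) (τ := show Γ(Y, W) from ψ.app W s)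
      fun hW => H W hW s

/-- `div(h)` and `D` are the same divisor iff `h / f_i` is a unit on every `U_i` (the hypothesis of `unitIsoOfRatFn`,
and the third clause of ★ `exists_ratFn_of_iso_unit`). [cite: GortzWedhorn2020, Def. 11.20 and Section (11.9) (p. 301)] -/
theorem sameDivisor_principal_iff (h : Y.functionField) (hh : h ≠ 0) :
    (principal h hh).SameDivisor D ↔ ∀ (i : D.ι) (x : Y), x ∈ D.U i → IsUnitAt x (h / D.f i) :=
  ⟨fun H i x hx => H ⟨⟩ i x trivial hx, fun H _ i x _ hx => H i x hx⟩

variable (h : Y.functionField) (hD : ∀ (i : D.ι) (x : Y), x ∈ D.U i → IsUnitAt x (h / D.f i))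

/-! ### §1 Multiplication by `h`: the morphism `𝒪_Y(D) → 𝒪_Y` and its inverse -/

open scoped Classical in
/-- The value `φ(s) · h ∈ Γ(W, 𝒪_Y)` of multiplication by `h` on a section `s` of the glued line bundle over `W` (the
rational function `φ(s) h = (f_{i(z)} φ(s)) · (h / f_{i(z)})` is regular at every `z ∈ W`; junk `0` over `W = ∅`).
[cite: GortzWedhorn2020, Section (11.9) (p. 301)] -/
def mulRatFnFun {W : Y.Opens} (s : Γ(Modules.lineBundle D.toUnitCocycle, W)) : Γ(Y, W) :=
  if hW : genericPoint Y ∈ W then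
    sectionOf hW (D.lineBundleRatFn hW s * h) fun z hz => by
      have h1 := (D.isSectionOn_lineBundleRatFn hW s) (D.chartIdx z) z (D.mem_U_chartIdx z) hz
      have h2 := (hD (D.chartIdx z) z (D.mem_U_chartIdx z)).isRegularAt
      have e : D.lineBundleRatFn hW s * h = D.f (D.chartIdx z) * D.lineBundleRatFn hW s * (h / D.f (D.chartIdx z)) := by
        field_simp [D.f_ne_zero (D.chartIdx z)]
      rw [e]
      exact h1.mul h2
  else 0

/-- The rational function of `mulRatFnFun s` is `φ(s) · h`. [cite: GortzWedhorn2020, Section (11.9) (p. 301)] -/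
theorem ofSection_mulRatFnFun {W : Y.Opens} (hW : genericPoint Y ∈ W)
    (s : Γ(Modules.lineBundle D.toUnitCocycle, W)) :
    ofSection hW (D.mulRatFnFun h hD s) = D.lineBundleRatFn hW s * h := by
  simp only [mulRatFnFun, dif_pos hW]
  exact ofSection_sectionOf _ _ _

/-- `mulRatFnFun` is additive. [cite: GortzWedhorn2020, Section (11.9) (p. 301)] -/
theorem mulRatFnFun_add {W : Y.Opens} (s t : Γ(Modules.lineBundle D.toUnitCocycle, W)) :
    D.mulRatFnFun h hD (s + t) = D.mulRatFnFun h hD s + D.mulRatFnFun h hD t :=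
  RatFn.section_ext fun hW => by
    rw [ofSection_add', ofSection_mulRatFnFun, ofSection_mulRatFnFun, ofSection_mulRatFnFun, lineBundleRatFn_add,
      add_mul]

/-- `mulRatFnFun 0 = 0`. [cite: GortzWedhorn2020, Section (11.9) (p. 301)] -/
theorem mulRatFnFun_zero {W : Y.Opens} :
    D.mulRatFnFun h hD (0 : Γ(Modules.lineBundle D.toUnitCocycle, W)) = 0 :=
  RatFn.section_ext fun hW => by
    rw [ofSection_mulRatFnFun, lineBundleRatFn_zero, zero_mul, ofSection_zero']

/-- `mulRatFnFun` is `Γ(W, 𝒪_Y)`-linear. [cite: GortzWedhorn2020, Section (11.9) (p. 301)] -/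
theorem mulRatFnFun_smul {W : Y.Opens} (b : Γ(Y, W)) (s : Γ(Modules.lineBundle D.toUnitCocycle, W)) :
    D.mulRatFnFun h hD (b • s) = b * D.mulRatFnFun h hD s :=
  RatFn.section_ext fun hW => by
    rw [ofSection_mul', ofSection_mulRatFnFun, ofSection_mulRatFnFun, lineBundleRatFn_smul, mul_assoc]

/-- `mulRatFnFun` is compatible with restriction. [cite: GortzWedhorn2020, Section (11.9) (p. 301)] -/
theorem mulRatFnFun_map {W W' : Y.Opens} (i : W' ⟶ W) (s : Γ(Modules.lineBundle D.toUnitCocycle, W)) :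
    D.mulRatFnFun h hD ((Modules.lineBundle D.toUnitCocycle).presheaf.map i.op s) =
      Y.presheaf.map i.op (D.mulRatFnFun h hD s) :=
  RatFn.section_ext fun hW' => by
    rw [ofSection_mulRatFnFun, lineBundleRatFn_map, ofSection_map, ofSection_mulRatFnFun]

/-- **Multiplication by `h`, `𝒪_Y(D) → 𝒪_Y`**, as a morphism of `𝒪_Y`-modules (`s ↦ φ(s) · h` on every open).
[cite: GortzWedhorn2020, Section (11.9) (p. 301) and Prop. 11.21 (p. 302)] -/
def mulRatFnHom : Modules.lineBundle D.toUnitCocycle ⟶ SheafOfModules.unit Y.ringCatSheaf where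
  val := PresheafOfModules.homMk
    { app := fun W => AddCommGrpCat.ofHom
        { toFun := fun s => (D.mulRatFnFun h hD (W := W.unop) s : Γ(Y, W.unop))
          map_zero' := D.mulRatFnFun_zero h hD
          map_add' := fun s t => D.mulRatFnFun_add h hD s t }
      naturality := fun {W W'} i => by
        ext s
        exact D.mulRatFnFun_map h hD i.unop s }
    (fun W b s => D.mulRatFnFun_smul h hD (W := W.unop) b s)

/-- The values of `mulRatFnHom` (definitional). [cite: GortzWedhorn2020, Section (11.9) (p. 301)] -/
@[simp]
theorem mulRatFnHom_app {W : Y.Opens} (s : Γ(Modules.lineBundle D.toUnitCocycle, W)) :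
    (D.mulRatFnHom h hD).app W s = D.mulRatFnFun h hD s := rfl

open scoped Classical in
/-- The value of division by `h` on `b ∈ Γ(W, 𝒪_Y)`: the section of the glued line bundle with rational function
`b / h` (`f_i · b / h = b · (h / f_i)⁻¹` is regular on `W ∩ U_i`; junk `0` over `W = ∅`).
[cite: GortzWedhorn2020, Section (11.9) (p. 301)] -/
def divRatFnFun {W : Y.Opens} (b : Γ(Y, W)) : Γ(Modules.lineBundle D.toUnitCocycle, W) :=
  if hW : genericPoint Y ∈ W then
    D.lineBundleSectionOfRatFn hW (ofSection hW b / h) fun i z hi hz => by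
      have h1 : IsRegularAt z (ofSection hW b) := isRegularAt_ofSection hz b
      have h2 := (hD i z hi).inv.isRegularAt
      rw [inv_div] at h2
      have e : D.f i * (ofSection hW b / h) = ofSection hW b * (D.f i / h) := by ring
      rw [e]
      exact h1.mul h2
  else 0

/-- The rational function of `divRatFnFun b` is `b / h`. [cite: GortzWedhorn2020, Section (11.9) (p. 301)] -/
theorem lineBundleRatFn_divRatFnFun {W : Y.Opens} (hW : genericPoint Y ∈ W) (b : Γ(Y, W)) :
    D.lineBundleRatFn hW (D.divRatFnFun h hD b) = ofSection hW b / h := by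
  simp only [divRatFnFun, dif_pos hW]
  exact D.lineBundleRatFn_lineBundleSectionOfRatFn hW _ _

/-- `divRatFnFun` is additive. [cite: GortzWedhorn2020, Section (11.9) (p. 301)] -/
theorem divRatFnFun_add {W : Y.Opens} (a b : Γ(Y, W)) :
    D.divRatFnFun h hD (a + b) = D.divRatFnFun h hD a + D.divRatFnFun h hD b :=
  D.lineBundle_section_ext fun hW => by
    rw [lineBundleRatFn_add, lineBundleRatFn_divRatFnFun, lineBundleRatFn_divRatFnFun, lineBundleRatFn_divRatFnFun,
      ofSection_add', add_div]

/-- `divRatFnFun 0 = 0`. [cite: GortzWedhorn2020, Section (11.9) (p. 301)] -/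
theorem divRatFnFun_zero {W : Y.Opens} : D.divRatFnFun h hD (0 : Γ(Y, W)) = 0 :=
  D.lineBundle_section_ext fun hW => by
    rw [lineBundleRatFn_divRatFnFun, lineBundleRatFn_zero, ofSection_zero', zero_div]

/-- `divRatFnFun` is `Γ(W, 𝒪_Y)`-linear. [cite: GortzWedhorn2020, Section (11.9) (p. 301)] -/
theorem divRatFnFun_smul {W : Y.Opens} (a b : Γ(Y, W)) :
    D.divRatFnFun h hD (a * b) = a • D.divRatFnFun h hD b :=
  D.lineBundle_section_ext fun hW => by
    rw [lineBundleRatFn_smul, lineBundleRatFn_divRatFnFun, lineBundleRatFn_divRatFnFun, ofSection_mul', mul_div_assoc]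

/-- `divRatFnFun` is compatible with restriction. [cite: GortzWedhorn2020, Section (11.9) (p. 301)] -/
theorem divRatFnFun_map {W W' : Y.Opens} (i : W' ⟶ W) (b : Γ(Y, W)) :
    D.divRatFnFun h hD (Y.presheaf.map i.op b) =
      (Modules.lineBundle D.toUnitCocycle).presheaf.map i.op (D.divRatFnFun h hD b) :=
  D.lineBundle_section_ext fun hW' => by
    rw [lineBundleRatFn_divRatFnFun, lineBundleRatFn_map, lineBundleRatFn_divRatFnFun, ofSection_map]

/-- **Division by `h`, `𝒪_Y → 𝒪_Y(D)`**, as a morphism of `𝒪_Y`-modules (`b ↦` the section with rational function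
`b / h`). [cite: GortzWedhorn2020, Section (11.9) (p. 301) and Prop. 11.21 (p. 302)] -/
def divRatFnHom : unitModule Y ⟶ Modules.lineBundle D.toUnitCocycle where
  val := PresheafOfModules.homMk
    { app := fun W => AddCommGrpCat.ofHom
        { toFun := fun b => D.divRatFnFun h hD (W := W.unop) b
          map_zero' := D.divRatFnFun_zero h hD
          map_add' := fun a b => D.divRatFnFun_add h hD a b }
      naturality := fun {W W'} i => by
        ext b
        exact D.divRatFnFun_map h hD i.unop b }
    (fun W a b => D.divRatFnFun_smul h hD (W := W.unop) a b)

/-- The values of `divRatFnHom` (definitional). [cite: GortzWedhorn2020, Section (11.9) (p. 301)] -/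
@[simp]
theorem divRatFnHom_app {W : Y.Opens} (b : Γ(Y, W)) :
    (D.divRatFnHom h hD).app W (show Γ(SheafOfModules.unit Y.ringCatSheaf, W) from b) = D.divRatFnFun h hD b := rfl

/-- `(s ↦ φ(s) h) ≫ (b ↦ b / h) = 𝟙`. [cite: GortzWedhorn2020, Section (11.9) (p. 301)] -/
theorem mulRatFnHom_comp_divRatFnHom : D.mulRatFnHom h hD ≫ D.divRatFnHom h hD = 𝟙 _ := by
  -- `h ≠ 0`: `h / f_i` is a unit at the generic point
  obtain ⟨i, hi⟩ := D.covers (genericPoint Y)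
  have hh : h ≠ 0 := fun h0 => (hD i _ hi).ne_zero (by rw [h0, zero_div])
  refine Scheme.Modules.hom_ext _ _ fun W => AddCommGrpCat.ext fun s => ?_
  change D.divRatFnFun h hD (D.mulRatFnFun h hD s) = s
  refine D.lineBundle_section_ext fun hW => ?_
  rw [lineBundleRatFn_divRatFnFun, ofSection_mulRatFnFun, mul_div_cancel_right₀ _ hh]

/-- `(b ↦ b / h) ≫ (s ↦ φ(s) h) = 𝟙`. [cite: GortzWedhorn2020, Section (11.9) (p. 301)] -/
theorem divRatFnHom_comp_mulRatFnHom : D.divRatFnHom h hD ≫ D.mulRatFnHom h hD = 𝟙 _ := by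
  obtain ⟨i, hi⟩ := D.covers (genericPoint Y)
  have hh : h ≠ 0 := fun h0 => (hD i _ hi).ne_zero (by rw [h0, zero_div])
  refine Scheme.Modules.hom_ext _ _ fun W => AddCommGrpCat.ext fun b => ?_
  change D.mulRatFnFun h hD (D.divRatFnFun h hD b) = b
  refine RatFn.section_ext fun hW => ?_
  rw [ofSection_mulRatFnFun, lineBundleRatFn_divRatFnFun, div_mul_cancel₀ _ hh]

/-- **THE TRIVIALISATION `𝒪_Y(D) ≅ 𝒪_Y` GIVEN BY MULTIPLICATION BY `h`**, for `h ∈ K(Y)` with `h / f_i ∈ Γ(U_i, 𝒪_Y^×)`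
for all `i` (i.e. `D = div(h)` as divisors): the converse of ★ `exists_ratFn_of_iso_unit` ([GortzWedhorn2020]
Prop. 11.21: `𝒪_X(D) ≅ 𝒪_X` iff `D` is principal). [cite: GortzWedhorn2020, Prop. 11.21 (p. 302)] -/
def unitIsoOfRatFn : Modules.lineBundle D.toUnitCocycle ≅ SheafOfModules.unit Y.ringCatSheaf where
  hom := D.mulRatFnHom h hD
  inv := D.divRatFnHom h hD
  hom_inv_id := D.mulRatFnHom_comp_divRatFnHom h hD
  inv_hom_id := D.divRatFnHom_comp_mulRatFnHom h hD

/-- **`e_h(s) = φ(s) · h` in `K(Y)`** for every section `s` over every non-empty open `W` — the clause of ★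
`exists_ratFn_of_iso_unit`, now for the named isomorphism `unitIsoOfRatFn D h`.
[cite: GortzWedhorn2020, Section (11.9) (p. 301) and Prop. 11.21 (p. 302)] -/
theorem ofSection_unitIsoOfRatFn_hom_app {W : Y.Opens} (hW : genericPoint Y ∈ W)
    (s : Γ(Modules.lineBundle D.toUnitCocycle, W)) :
    ofSection hW (show Γ(Y, W) from (D.unitIsoOfRatFn h hD).hom.app W s) = D.lineBundleRatFn hW s * h :=
  D.ofSection_mulRatFnFun h hD hW s

/-- **`φ(e_h⁻¹(b)) = b / h` in `K(Y)`** for every `b ∈ Γ(W, 𝒪_Y)`, `W` non-empty.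
[cite: GortzWedhorn2020, Section (11.9) (p. 301) and Prop. 11.21 (p. 302)] -/
theorem lineBundleRatFn_unitIsoOfRatFn_inv_app {W : Y.Opens} (hW : genericPoint Y ∈ W) (b : Γ(Y, W)) :
    D.lineBundleRatFn hW ((D.unitIsoOfRatFn h hD).inv.app W (show Γ(SheafOfModules.unit Y.ringCatSheaf, W) from b)) =
      ofSection hW b / h :=
  D.lineBundleRatFn_divRatFnFun h hD hW b

omit [IsIntegral Y] in
/-- `ofSection` of `1` is `1`. [cite: GortzWedhorn2020, Prop. 3.29 (2) (p. 80)] -/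
private theorem ofSection_one'' [IsIntegral Y] {U : Y.Opens} (hU : genericPoint Y ∈ U) :
    ofSection hU (1 : Γ(Y, U)) = 1 :=
  map_one (Y.presheaf.germ U (genericPoint Y) hU).hom

/-- The rational function of the local generator `t_z` over `V ≤ U_z` is `1 / f_{i(z)}`.
[cite: GortzWedhorn2020, Section (11.9) (p. 301)] -/
theorem lineBundleRatFn_lineBundleGen (z : Y) {V : Y.Opens} (hV : V ≤ D.toUnitCocycle.U z)
    (hξ : genericPoint Y ∈ V) :
    D.lineBundleRatFn hξ (D.toUnitCocycle.lineBundleGen z V hV) = (D.f (D.chartIdx z))⁻¹ := by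
  rw [D.lineBundleRatFn_eq hξ _ z, UnitCocycle.comp_lineBundleGen, D.toUnitCocycle.g_self, ofSection_one'', one_div]

/-- **`e_h(t_z) = h / f_{i(z)}`**: the trivialisation maps the local generator over `V ≤ U_z` to the unit
`h / f_{i(z)}` (so its transition data match: `t_w = g_{zw} t_z`, `g_{zw} = f_{i(z)}/f_{i(w)}`).
[cite: GortzWedhorn2020, Section (11.9) (p. 301) and Rem. 11.16] -/
theorem ofSection_unitIsoOfRatFn_hom_app_lineBundleGen (z : Y) {V : Y.Opens} (hV : V ≤ D.toUnitCocycle.U z)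
    (hξ : genericPoint Y ∈ V) :
    ofSection hξ (show Γ(Y, V) from (D.unitIsoOfRatFn h hD).hom.app V (D.toUnitCocycle.lineBundleGen z V hV)) =
      h / D.f (D.chartIdx z) := by
  rw [ofSection_unitIsoOfRatFn_hom_app, lineBundleRatFn_lineBundleGen, inv_mul_eq_div]

/-- The value of `e_h` on the local generator is a unit section. [cite: GortzWedhorn2020, Section (11.9) (p. 301)] -/
theorem isUnit_unitIsoOfRatFn_hom_app_lineBundleGen (z : Y) {V : Y.Opens} (hV : V ≤ D.toUnitCocycle.U z) :
    IsUnit (show Γ(Y, V) from (D.unitIsoOfRatFn h hD).hom.app V (D.toUnitCocycle.lineBundleGen z V hV)) :=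
  D.isUnit_hom_app_lineBundleGen _ z V hV

/-! ### §2 Faithfulness: every trivialisation is multiplication by its rational function -/

/-- **An isomorphism `e : 𝒪_Y(D) ≅ 𝒪_Y` with `e(s) = φ(s) · h` for all sections IS `unitIsoOfRatFn D h`.**
[cite: GortzWedhorn2020, Prop. 11.21 (p. 302) with Prop. 3.29 (2) (p. 80)] -/
theorem eq_unitIsoOfRatFn (e : Modules.lineBundle D.toUnitCocycle ≅ SheafOfModules.unit Y.ringCatSheaf)
    (he : ∀ (W : Y.Opens) (hW : genericPoint Y ∈ W) (s : Γ(Modules.lineBundle D.toUnitCocycle, W)),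
      ofSection hW (show Γ(Y, W) from e.hom.app W s) = D.lineBundleRatFn hW s * h) :
    e = D.unitIsoOfRatFn h hD :=
  Iso.ext (D.hom_ext_ofSection fun W hW s => by rw [he, ofSection_unitIsoOfRatFn_hom_app])

/-- A morphism `ψ : 𝒪_Y(D) ⟶ 𝒪_Y` with `ψ(s) = φ(s) · h` for all sections is the `hom` of `unitIsoOfRatFn D h` (in
particular an isomorphism). [cite: GortzWedhorn2020, Prop. 11.21 (p. 302) with Prop. 3.29 (2) (p. 80)] -/
theorem eq_unitIsoOfRatFn_hom (ψ : Modules.lineBundle D.toUnitCocycle ⟶ SheafOfModules.unit Y.ringCatSheaf)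
    (hψ : ∀ (W : Y.Opens) (hW : genericPoint Y ∈ W) (s : Γ(Modules.lineBundle D.toUnitCocycle, W)),
      ofSection hW (show Γ(Y, W) from ψ.app W s) = D.lineBundleRatFn hW s * h) :
    ψ = (D.unitIsoOfRatFn h hD).hom :=
  D.hom_ext_ofSection fun W hW s => by rw [hψ, ofSection_unitIsoOfRatFn_hom_app]

omit hD in
/-- **EVERY isomorphism `𝒪_Y(D) ≅ 𝒪_Y` is multiplication by a rational function `h` with `h / f_i ∈ Γ(U_i, 𝒪_Y^×)`**
(★ `exists_ratFn_of_iso_unit` gives `h`; `eq_unitIsoOfRatFn` identifies `e`): isomorphisms `𝒪_Y(D) ≅ 𝒪_Y`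
correspond exactly to such `h` ([GortzWedhorn2020] Prop. 11.21; on an integral scheme `Aut(𝒪_Y) = Γ(Y, 𝒪_Y)^×`).
[cite: GortzWedhorn2020, Prop. 11.21 (p. 302)] -/
theorem exists_eq_unitIsoOfRatFn (e : Modules.lineBundle D.toUnitCocycle ≅ SheafOfModules.unit Y.ringCatSheaf) :
    ∃ (h : Y.functionField) (hD : ∀ (i : D.ι) (x : Y), x ∈ D.U i → IsUnitAt x (h / D.f i)),
      e = D.unitIsoOfRatFn h hD := by
  obtain ⟨h, -, he, hu⟩ := D.exists_ratFn_of_iso_unit e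
  exact ⟨h, hu, D.eq_unitIsoOfRatFn h hu e fun W hW s => he hW s⟩

/-- **Two trivialisations differ by the global unit `h' / h`**: if `e(s) = φ(s) h` and `e'(s) = φ(s) h'`, then
`e'(e⁻¹(b)) = b · (h' / h)` in `K(Y)` for every `b ∈ Γ(W, 𝒪_Y)`. [cite: GortzWedhorn2020, Prop. 11.21 (p. 302)] -/
theorem ofSection_unitIsoOfRatFn_inv_hom_app (h' : Y.functionField)
    (hD' : ∀ (i : D.ι) (x : Y), x ∈ D.U i → IsUnitAt x (h' / D.f i)) {W : Y.Opens} (hW : genericPoint Y ∈ W)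
    (b : Γ(Y, W)) :
    ofSection hW (show Γ(Y, W) from (D.unitIsoOfRatFn h' hD').hom.app W
        ((D.unitIsoOfRatFn h hD).inv.app W (show Γ(SheafOfModules.unit Y.ringCatSheaf, W) from b))) =
      ofSection hW b * (h' / h) := by
  rw [ofSection_unitIsoOfRatFn_hom_app, lineBundleRatFn_unitIsoOfRatFn_inv_app]
  ring

/-! ### §3 Principal divisors -/

omit hD in
/-- For the principal divisor `div(h) = (Y, h)` the hypothesis of `unitIsoOfRatFn` holds with `h` itself
(`h / h = 1`). [cite: GortzWedhorn2020, Section (11.9) (p. 301)] -/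
theorem isUnitAt_div_principal_f (hh : h ≠ 0) (i : (principal h hh).ι) (x : Y) (_hx : x ∈ (principal h hh).U i) :
    IsUnitAt x (h / (principal h hh).f i) := by
  change IsUnitAt x (h / h)
  rw [div_self hh]
  exact isUnitAt_one

omit hD in
/-- **`𝒪_Y(div h) ≅ 𝒪_Y` by multiplication by `h`** ([GortzWedhorn2020] (11.9): `𝒪_X(div h) = h⁻¹ 𝒪_X ⊆ 𝒦_X`,
a principal divisor has trivial line bundle). [cite: GortzWedhorn2020, Section (11.9) (p. 301) and Prop. 11.21 (p. 302)] -/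
def principalUnitIso (hh : h ≠ 0) :
    Modules.lineBundle (principal h hh).toUnitCocycle ≅ SheafOfModules.unit Y.ringCatSheaf :=
  (principal h hh).unitIsoOfRatFn h (isUnitAt_div_principal_f h hh)

omit hD in
/-- `principalUnitIso` on sections: `s ↦ φ(s) · h`. [cite: GortzWedhorn2020, Section (11.9) (p. 301)] -/
theorem ofSection_principalUnitIso_hom_app (hh : h ≠ 0) {W : Y.Opens} (hW : genericPoint Y ∈ W)
    (s : Γ(Modules.lineBundle (principal h hh).toUnitCocycle, W)) :
    ofSection hW (show Γ(Y, W) from (principalUnitIso h hh).hom.app W s) =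
      (principal h hh).lineBundleRatFn hW s * h :=
  (principal h hh).ofSection_unitIsoOfRatFn_hom_app h _ hW s

omit hD in
/-- `principalUnitIso⁻¹` on sections: `b ↦` the section with rational function `b / h`.
[cite: GortzWedhorn2020, Section (11.9) (p. 301)] -/
theorem lineBundleRatFn_principalUnitIso_inv_app (hh : h ≠ 0) {W : Y.Opens} (hW : genericPoint Y ∈ W)
    (b : Γ(Y, W)) :
    (principal h hh).lineBundleRatFn hW
        ((principalUnitIso h hh).inv.app W (show Γ(SheafOfModules.unit Y.ringCatSheaf, W) from b)) =
      ofSection hW b / h :=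
  (principal h hh).lineBundleRatFn_unitIsoOfRatFn_inv_app h _ hW b

end Literature.AlgebraicGeometry.Motives.CartierDivisor

end
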